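import Mathlib.RingTheory.Nullstellensatz
import Mathlib.RingTheory.MvPolynomial.Tower
import Mathlib.LinearAlgebra.Matrix.Charpoly.Basic
import Literature.NumberTheory.Automorphic.LinearAlgebraicGroups
import Literature.NumberTheory.Automorphic.AutomorphicRepsGL
import HarnessLib
import HarnessLib.Audit

-- provenance: harness21/H21/H21/Statements/Lang/Sweep2.lean @ f403dde (interim HEAD d8f2665); M5 mechanical rewrite
/-!
# Langlands family (`lang`) — statement sweep 2
(statements **lang.S12** (partial), **lang.S04** (partial))

Family `lang` (gap inventory 2026-08-12), statement file `H21/Statements/Lang/Sweep2.lean`,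
`namespace Literature.Lang`. Round 2 targets: lang.S01, S04, S05, S10, S12, S25, S26.

## Covered inventory ids

* **lang.S12** (Borel, *Linear Algebraic Groups* (2nd ed.), AG §§11–12, §11, §16;
  Springer, *Linear Algebraic Groups* (2nd ed.), Ch. 11–12, 16) — **partial** (definition item).
  In the `K`-points model of the accepted prelude `LinearAlgebraicGroups` (subgroups
  `G ≤ GL n K`, `K` algebraically closed, with `IsConnectedReductive`, `IsBorelIn`, …) we add
  Borel's `k`-structures for a subfield `k ⊆ K` (`[Algebra k K]`): `IsDefinedOver k V`
  (Borel AG 11.1–11.2: the ideal `I_K(V)` of all polynomials vanishing on `V` is generated by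
  its `k`-rational part `I_k(V)`; both are Mathlib's `MvPolynomial.vanishingIdeal`),
  `IsConnectedReductiveOver k G` (a connected reductive `k`-group, Borel 11.21 with AG §12),
  and `IsQuasiSplitOver k G` (a Borel subgroup defined over `k`; Borel–Tits 1965 §4;
  Springer Ch. 16). The definitional target is restated with the bold id as:
  `IsDefinedOver.of_isScalarTower` (base change `k ⊆ k' ⊆ K` preserves `k`-structures; real
  proof), `isQuasiSplitOver_self` (over `K = k` algebraically closed every connected `G` is
  quasi-split: Borel subgroups exist, Borel 11.1) and Lang's theorem `isQuasiSplitOver_of_finite`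
  (a connected `k`-group over a finite field `k` contains a Borel subgroup defined over `k`;
  Lang, *Amer. J. Math.* 78 (1956); Borel 16.6). *Not covered:* the last clause "inner and outer
  forms classified by `H¹(k, G_ad)`, `H¹(k, Aut G)`" — missing notion: non-abelian (continuous)
  Galois cohomology sets `H¹(k, A)` for a `Γ_k`-group `A` and the `Γ_k`-action on
  `Aut(G_{k_s})` (the accepted `GaloisCohomology` prelude only has cohomology of discrete
  *abelian* Galois modules), together with `k`-isomorphism classes of `k`-forms.
* **lang.S04** (Langlands, *Problems in the theory of automorphic forms* (1970), Questions 1–2;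
  Borel, *Automorphic L-functions*, Corvallis 1979, §§15–17) — **partial**: functoriality in the
  case `H = GL_m`, `G = GL_n` over a number field `K` and an L-homomorphism
  `ᴸu = r × id : GL_m(ℂ) × Γ_K → GL_n(ℂ) × Γ_K` trivial on the Galois factor, i.e. an algebraic
  homomorphism `r : GL_m(ℂ) → GL_n(ℂ)`, with the Satake compatibility (F1): for every
  automorphic representation `π` of `GL_m(𝔸_K)` there is an automorphic representation `Π` of
  `GL_n(𝔸_K)` with `c(Π_v) = r(c(π_v))` for almost all finite `v`
  (`def FunctorialityGLConjecture m n K : Prop`, open in this generality). (F3), the equality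
  `L^S(s, Π, r') = L^S(s, π, r' ∘ r)` of partial L-functions, is a formal consequence of (F1)
  since both sides are Euler products over the Satake classes. *Not covered:* general
  (quasi-split) `G` and general `H` (no automorphic representations / Satake parameters of a
  general `G(𝔸_F)` in H21: `automorphic_representation`, `satake_isomorphism` beyond `GL_n`),
  L-homomorphisms non-trivial on `Γ_F` (this includes the strong Artin conjecture), and (F2),
  compatibility with the local correspondence `rec` at *all* places (needs the archimedean
  local Langlands correspondence, `archimedean_gK_module`, and ramified `π_v ↦ rec(π_v)` for
  automorphic `π`, `HasLocalComponentAt` only exists on the `L²` side).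

## Ids of the round NOT covered, with the precise missing notion

* lang.S01 (local Langlands for every connected reductive `G`, desiderata (D1)–(D9), Kaletha's
  rigid refinement) and lang.S10 (Fargues–Scholze): the smooth dual `Irr(G(F))` of a general
  connected reductive `G/F` *together with* parabolic induction from Levi subgroups, character
  twists, central/cocentral characters and, for S10, `ℓ`-adic semisimple parameters and the
  Bernstein centre; the accepted `ConnectedReductiveGroupData` carries `G(F)` and `ᴸG` but no
  Levi/parabolic structure, so "compatible with parabolic induction" (the property that makes
  the FS map non-vacuous beyond `GL_n`) is not expressible; a bare `∃ map` would be hollow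
  (`connected_reductive_group`, `parabolic_induction_jacquet`, `endoscopy_transfer`).
* lang.S05 (Arthur's multiplicity formula for general `G`), lang.S25 (endoscopic
  classification for quasi-split `Sp(2n)`, `SO(N)`): the accepted `ArthurParameters` prelude has
  the honest combinatorics (`FormalGlobalParameterGL`, `epsCharacter`, `sGroupFormal`) and the
  *hypothesis structure* `ArthurPacketData` with the untagged shape
  `ArthurMultiplicityStatement`, but H21 has no adelic classical groups `Sp_{2n}(𝔸_K)`,
  `SO_N(𝔸_K)` as `AdelicGroupData` instances, no local Arthur packets `Π_ψ` (defined by twisted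
  endoscopic character identities, Arthur 2013 Thm. 2.2.1) and no Satake parameters for
  discrete automorphic representations of a general `G` (`endoscopy_transfer`,
  `L2_discrete_spectrum` for classical groups); asserting `∃ data, ArthurMultiplicityStatement
  data` would be hollow.
* lang.S26 (invariant / stable trace formula): the distributions `I_geom`, `I_spec` on
  `C_c^∞(G(𝔸_F)¹)` (weighted orbital integrals, weighted characters, truncation), stable
  distributions `S^{G'}` and transfer factors `ι(G, G')` (`trace_formula`, `endoscopy_transfer`,
  `haar_measure` on `G(𝔸_F)¹`); nothing of this exists in H21 or Mathlib.

## Mathlib search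

Used: `MvPolynomial.vanishingIdeal k V` (`Mathlib/RingTheory/Nullstellensatz.lean`, the ideal
of `k`-polynomials vanishing on `V ⊆ Kσ` for an extension `K/k` — exactly Borel's `I_k(V)`),
`Ideal.map`, `MvPolynomial.map`, `IsScalarTower`, `Matrix.charpoly`, `Polynomial.roots`,
`Filter.cofinite`. Mathlib has no `k`-structures on varieties, no quasi-split groups, no
Lang's theorem (`rg -i 'quasi.?split|Lang.s theorem|defined ?over'`: no relevant hits) and no
automorphic representations. H21: `IsZConnected`, `IsConnectedReductive`, `IsBorelIn`,
`glCoordFun`, `GLCoord`, `diagonalGL`, `MonoidHom.IsAlgebraicGL` (`LinearAlgebraicGroups`);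
`AutomorphicRepData (AutomorphyDatum.gl n K)`, `AutomorphicRepData.HasSatakeParamAt`
(`AutomorphicRepsGL`, `AutomorphicForms`, `AdelicGLnGlue`).

## Design choices

* `k`-structures follow Borel's book literally (varieties = `K`-points, `K` algebraically
  closed, plus a `k`-structure), which is the model of the accepted prelude; a closed subgroup
  of `GL_n` defined over `k` as a variety is automatically a `k`-group (Borel AG §12 with
  §1.7: `μ`, `ι` of `GL_n` are defined over the prime field). `IsDefinedOver` is stated for an
  arbitrary `V ⊆ GL n K` through the coordinates `glCoordFun : GL n K → (GLCoord n → K)` of the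
  prelude, so that it applies to `G` and to its Borel subgroups alike.
* `IsQuasiSplitOver` does not itself demand reductivity or connectedness (Borel 16.6 is stated
  for connected `k`-groups); `IsConnectedReductiveOver` bundles the S12 notion.
* Functoriality: Satake classes are handled as in `Sweep1`: `c(π_v)` is the multiset of
  eigenvalues `d : Fin m → ℂˣ` (`HasSatakeParamAt`), and `r(c(π_v))` is the multiset of roots
  of the characteristic polynomial of `r (diag d) ∈ GL_n(ℂ)` (independent of the order of `d`
  since `r` is a homomorphism and permutation matrices lie in `GL_m(ℂ)`). Algebraicity of `r`
  is the prelude's `MonoidHom.IsAlgebraicGL` applied to `r` restricted along `⊤ ≤ GL_m(ℂ)`.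
* Number fields live in `Type` (universe discipline of `AdelicGroupData.gl`).
* No new instances; unproved literature results (`isQuasiSplitOver_self`,
  `isQuasiSplitOver_of_finite`) are named facts `def … : Prop` (D-0014), as are open problems.

## References

* A. Borel, *Linear Algebraic Groups*, 2nd ed., GTM 126 (1991), AG §§11–12, §§1.7, 11.1,
  11.21, 16.6.
* T. A. Springer, *Linear Algebraic Groups*, 2nd ed. (1998), Ch. 11–12, 16.
* S. Lang, *Algebraic groups over finite fields*, Amer. J. Math. 78 (1956), 555–563.
* R. P. Langlands, *Problems in the theory of automorphic forms*, LNM 170 (1970).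
* A. Borel, *Automorphic L-functions*, Proc. Sympos. Pure Math. 33 (1979), part 2, §§15–17.
-/

noncomputable section

open scoped MatrixGroups Polynomial
open NumberField IsDedekindDomain

namespace Literature.NumberTheory.Automorphic

open Literature.NumberTheory.Automorphic -- dot-notation `MonoidHom.IsAlgebraicGL` (declared in this namespace) is found through `open`, not through the enclosing namespace


/-! ### lang.S12: `k`-structures, connected reductive `k`-groups, quasi-split groups -/

section KStructures

variable (k : Type*) {K : Type*} [Field k] [Field K] [Algebra k K]
variable {n : Type*} [Fintype n] [DecidableEq n]

/-- A subset `V ⊆ GL n K` (typically a closed subgroup; `K` algebraically closed) is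
**defined over the subfield `k`** if the ideal `I_K(V)` of all polynomials in the coordinates
`x i j, det⁻¹` vanishing on `V` is generated by its `k`-rational part `I_k(V) = I_K(V) ∩ k[x, det⁻¹]`,
i.e. `I_K(V) = I_k(V) · K[x, det⁻¹]`. Both ideals are Mathlib's `MvPolynomial.vanishingIdeal`
(over `K`, resp. over `k`, of the set of coordinate vectors of `V`).
Ref: Borel, *Linear Algebraic Groups*, AG 11.1–11.2, AG 12.1; Springer, Ch. 11 (`F`-structures). [folklore] -/
def IsDefinedOver (V : Set (GL n K)) : Prop :=
  MvPolynomial.vanishingIdeal K (glCoordFun '' V) =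
    Ideal.map (MvPolynomial.map (algebraMap k K))
      (MvPolynomial.vanishingIdeal k (glCoordFun '' V) : Ideal (MvPolynomial (GLCoord n) k))

/-- The inclusion `I_k(V) · K[x] ≤ I_K(V)` always holds: a `k`-polynomial vanishing on `V` still
vanishes on `V` after extending scalars (Borel AG 11.1). [folklore] -/
theorem map_vanishingIdeal_le (V : Set (GL n K)) :
    Ideal.map (MvPolynomial.map (algebraMap k K))
        (MvPolynomial.vanishingIdeal k (glCoordFun '' V) :
          Ideal (MvPolynomial (GLCoord n) k)) ≤
      MvPolynomial.vanishingIdeal K (glCoordFun '' V) := by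
  refine Ideal.map_le_iff_le_comap.mpr fun p hp => ?_
  simp only [Ideal.mem_comap, MvPolynomial.mem_vanishingIdeal_iff] at hp ⊢
  intro x hx
  rw [MvPolynomial.aeval_map_algebraMap K x p]
  exact hp x hx

/-- Everything is defined over `K` itself (Borel AG 11.1). [folklore] -/
theorem isDefinedOver_self (V : Set (GL n K)) : IsDefinedOver K V := by
  refine le_antisymm (fun p hp => ?_) (map_vanishingIdeal_le K V)
  rw [← MvPolynomial.map_id p, ← Algebra.algebraMap_self]
  exact Ideal.mem_map_of_mem _ hp

/-- **lang.S12** (base change of `k`-structures; Borel AG 11.4). If `V ⊆ GL n K` is defined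
over `k` then it is defined over every intermediate field `k ⊆ k' ⊆ K`. [folklore] -/
theorem IsDefinedOver.of_isScalarTower (k' : Type*) [Field k'] [Algebra k k'] [Algebra k' K]
    [IsScalarTower k k' K] {V : Set (GL n K)} (h : IsDefinedOver k V) : IsDefinedOver k' V := by
  refine le_antisymm ?_ (map_vanishingIdeal_le k' V)
  rw [IsDefinedOver] at h
  rw [h]
  refine Ideal.map_le_iff_le_comap.mpr fun p hp => ?_
  rw [Ideal.mem_comap]
  have hmap : MvPolynomial.map (algebraMap k K) p =
      MvPolynomial.map (algebraMap k' K) (MvPolynomial.map (algebraMap k k') p) := by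
    rw [MvPolynomial.map_map, ← IsScalarTower.algebraMap_eq]
  rw [hmap]
  refine Ideal.mem_map_of_mem _ ?_
  simp only [MvPolynomial.mem_vanishingIdeal_iff] at hp ⊢
  intro x hx
  rw [MvPolynomial.aeval_map_algebraMap k' x p]
  exact hp x hx

/-- A **connected reductive group over `k`** in the `K`-points model (`K ⊇ k` algebraically
closed): a Zariski-connected reductive closed subgroup `G ≤ GL n K` (prelude
`IsConnectedReductive`: trivial unipotent radical) which is defined over `k`. A closed subgroup
of `GL_n` defined over `k` as a variety is a `k`-group (multiplication and inversion of `GL_n`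
are defined over the prime field). Ref: Borel, *Linear Algebraic Groups*, 1.7, 11.21, AG §12;
Springer, Ch. 12 and 16. [folklore] -/
def IsConnectedReductiveOver (G : Subgroup (GL n K)) : Prop :=
  IsConnectedReductive G ∧ IsDefinedOver k (G : Set (GL n K))

/-- `G ≤ GL n K` is **quasi-split over `k`**: it contains a Borel subgroup defined over `k`.
Ref: Borel–Tits, *Groupes réductifs*, Publ. Math. IHÉS 27 (1965), §4; Borel, *Linear Algebraic
Groups*, 16.6; Springer, Ch. 16; Borel, *Automorphic L-functions* (Corvallis 1979), §I.1. [cite: Corvallis1979] -/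
def IsQuasiSplitOver (G : Subgroup (GL n K)) : Prop :=
  ∃ B : Subgroup (GL n K), IsBorelIn B G ∧ IsDefinedOver k (B : Set (GL n K))

variable {k}

/-- A connected reductive `k`-group is connected reductive (definitional). [folklore] -/
theorem IsConnectedReductiveOver.isConnectedReductive {G : Subgroup (GL n K)}
    (h : IsConnectedReductiveOver k G) : IsConnectedReductive G := h.1

/-- A connected reductive `k`-group is defined over `k` (definitional). [folklore] -/
theorem IsConnectedReductiveOver.isDefinedOver {G : Subgroup (GL n K)}
    (h : IsConnectedReductiveOver k G) : IsDefinedOver k (G : Set (GL n K)) := h.2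

/-- Quasi-splitness is preserved under extension of the ground field `k ⊆ k' ⊆ K`
(Borel AG 11.4 applied to the Borel subgroup). [folklore] -/
theorem IsQuasiSplitOver.of_isScalarTower (k' : Type*) [Field k'] [Algebra k k'] [Algebra k' K]
    [IsScalarTower k k' K] {G : Subgroup (GL n K)} (h : IsQuasiSplitOver k G) :
    IsQuasiSplitOver k' G := by
  obtain ⟨B, hB, hBk⟩ := h
  exact ⟨B, hB, hBk.of_isScalarTower k k'⟩

variable (K n) in
/-- **lang.S12** (existence of Borel subgroups; Borel, *Linear Algebraic Groups*, 11.1;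
Springer 6.2). Over the algebraically closed field `K` itself every Zariski-connected closed
subgroup `G ≤ GL n K` is quasi-split, i.e. has a Borel subgroup (trivially defined over `K`).
Named fact (D-0014), not proved here; `K`, `n` explicit, `G` quantified inside:
usage `(h : isQuasiSplitOver_self K n)`, then `h hG`. [cite: Borel1991, Thm. 11.1] -/
def isQuasiSplitOver_self : Prop :=
  ∀ [IsAlgClosed K] ⦃G : Subgroup (GL n K)⦄, IsZConnected G → IsQuasiSplitOver K G

variable (k K n) in
/-- **lang.S12** (Lang's theorem; Lang, *Amer. J. Math.* 78 (1956), Thm. 2 and Cor.; Borel,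
*Linear Algebraic Groups*, 16.6; Steinberg, *Endomorphisms of linear algebraic groups*, Mem. AMS
80 (1968), §10). A connected `k`-group over a **finite**
field `k` is quasi-split: every Zariski-connected closed subgroup `G ≤ GL n K` (`K ⊇ k`
algebraically closed) defined over `k` contains a Borel subgroup defined over `k`. In particular
every connected reductive group over a finite field is quasi-split. Named fact (D-0014), not
proved here; `k`, `K`, `n` explicit, `G` quantified inside: usage
`(hLang : isQuasiSplitOver_of_finite k K n)`, then `hLang hG hk`. [cite: Lang1956, Thm. 2 and Cor.] -/
def isQuasiSplitOver_of_finite : Prop :=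
  ∀ [Finite k] [IsAlgClosed K] ⦃G : Subgroup (GL n K)⦄,
    IsZConnected G → IsDefinedOver k (G : Set (GL n K)) → IsQuasiSplitOver k G

/-- **lang.S12** (corollary for the reductive case, the form used in the Langlands programme:
Borel, *Automorphic L-functions* (Corvallis 1979), §I.1; Borel 16.6). A connected reductive
group over a finite field is quasi-split. Proved from Lang's theorem, taken as the named fact
`hLang : isQuasiSplitOver_of_finite k K n`. [cite: Corvallis1979] -/
theorem IsConnectedReductiveOver.isQuasiSplitOver_of_finite [Finite k] [IsAlgClosed K]
    (hLang : Literature.NumberTheory.Automorphic.isQuasiSplitOver_of_finite k K n) {G : Subgroup (GL n K)}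
    (hG : IsConnectedReductiveOver k G) : IsQuasiSplitOver k G :=
  hLang hG.1.1 hG.2

end KStructures

/-! ### lang.S04: Langlands functoriality, the case `GL_m → GL_n`, `ᴸu = r × id` -/

section Functoriality

-- `Fintype {w : InfinitePlace K // w.IsReal}` (hence the normed ring `mixedSpace K` carrying
-- `AutomorphyDatum.gl`) needs classical decidability, as in the prelude `AutomorphicRepsGL` (H5).
open scoped Classical

variable (m n : ℕ) (K : Type) [Field K] [NumberField K]
variable (hm : isCompact_glFiniteIntegralLevel m K) (hn : isCompact_glFiniteIntegralLevel n K)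

/-- The multiset `r(c)` of eigenvalues (roots of the characteristic polynomial, with
multiplicity) of the image under `r : GL_m(ℂ) → GL_n(ℂ)` of the diagonal (Satake) class with
eigenvalues `d : Fin m → ℂˣ`. For a homomorphism `r` it only depends on the multiset of the
`d i` (permutation matrices lie in `GL_m(ℂ)`). Ref: Borel, *Automorphic L-functions*
(Corvallis 1979), §§7.1, 16.1; Langlands (1970), §3. [cite: Corvallis1979] -/
def transferSatakeClass (r : GL (Fin m) ℂ →* GL (Fin n) ℂ) (d : Fin m → ℂˣ) : Multiset ℂ :=
  (Matrix.charpoly ((r (diagonalGL (Fin m) ℂ d) : GL (Fin n) ℂ) : Matrix (Fin n) (Fin n) ℂ)).roots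

/-- `Π` is a **weak functorial transfer of `π` along `r`** (Satake compatibility (F1)): for all
but finitely many finite places `v` of `K`, `π_v` and `Π_v` are unramified and the Satake class
of `Π_v` is `r(c(π_v))`, i.e. `π` has a Satake parameter `(d_1, …, d_m)` at `v` and `Π` has
Satake parameter the eigenvalues of `r(diag(d))` at `v` (prelude `HasSatakeParamAt`).
The automorphy data `AutomorphyDatum.gl _ K _` depend on the named facts
`hm`, `hn : isCompact_glFiniteIntegralLevel _ K` (M5 note of `AutomorphicRepsGL`), implicit here
(read off the types of `π`, `π'`).
Ref: Langlands, *Problems in the theory of automorphic forms* (1970), Question 2 / §3; Borel,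
*Automorphic L-functions* (Corvallis 1979), §16.1, §17.2. [cite: Corvallis1979] -/
def IsFunctorialTransferGL {hm hn} (r : GL (Fin m) ℂ →* GL (Fin n) ℂ)
    (π : AutomorphicRepData (AutomorphyDatum.gl m K hm))
    (π' : AutomorphicRepData (AutomorphyDatum.gl n K hn)) : Prop :=
  ∀ᶠ v in Filter.cofinite, ∃ d : Fin m → ℂˣ,
    π.HasSatakeParamAt v (Finset.univ.val.map fun i => (d i : ℂ)) ∧
      π'.HasSatakeParamAt v (transferSatakeClass m n r d)

/-- **lang.S04** (partial: `H = GL_m`, `G = GL_n`, L-homomorphism trivial on `Γ_K`; Langlands,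
*Problems in the theory of automorphic forms*, LNM 170 (1970), Questions 1–2; Borel,
*Automorphic L-functions* (Corvallis 1979), §§15–17, esp. 16.1, 17.2). **Langlands
functoriality for `GL_m → GL_n`** over the number field `K`: for every algebraic homomorphism
`r : GL_m(ℂ) → GL_n(ℂ)` (an L-homomorphism `ᴸGL_m → ᴸGL_n` trivial on the Galois factor) and
every automorphic representation `π` of `GL_m(𝔸_K)` (Borel–Jacquet, prelude
`AutomorphicRepData`) there is an automorphic representation `Π` of `GL_n(𝔸_K)` which is a weak
functorial transfer of `π` along `r`: `c(Π_v) = r(c(π_v))` for almost all `v` (F1); consequently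
`L^S(s, Π, r') = L^S(s, π, r' ∘ r)` for every `r'` (F3). Open in this generality (known e.g. for
`Symᵏ : GL₂ → GL_{k+1}` over `ℚ` for holomorphic `π`, Newton–Thorne 2021, cf. lang.S24).
Parameters `hm`, `hn : isCompact_glFiniteIntegralLevel _ K` as for `IsFunctorialTransferGL`. [cite: Corvallis1979] -/
@[conjecture] def FunctorialityGLConjecture : Prop :=
  ∀ r : GL (Fin m) ℂ →* GL (Fin n) ℂ,
    (r.comp (⊤ : Subgroup (GL (Fin m) ℂ)).subtype).IsAlgebraicGL →
      ∀ π : AutomorphicRepData (AutomorphyDatum.gl m K hm),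
        ∃ π' : AutomorphicRepData (AutomorphyDatum.gl n K hn),
          IsFunctorialTransferGL m n K r π π'

end Functoriality

end Literature.NumberTheory.Automorphic
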